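import Summits.RiemannHypothesis.RiemannHypothesis.Theorems.Splittings.LinearRayLehmerWindowLowQ
import Summits.RiemannHypothesis.RiemannHypothesis.Theorems.Splittings.LinearRayLehmerWindowCertSub
import Summits.RiemannHypothesis.RiemannHypothesis.Theorems.Splittings.LinearRayLehmerWindow
import Summits.RiemannHypothesis.RiemannHypothesis.Theorems.Splittings.LinearRayOnePointWindowB
import HarnessLib

/-!
# The linear-factor ray is refuted for every `0 < |a| ≤ 21`

Cell rh-split (D-0116 arm), ENGINE 5 (rh-splitx-eng-5 g4), lane (xviii-D) «LEHMER WINDOW DATA», ADDENDUM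
(file SUB): the sub-unity window `2/5 ≤ a ≤ 1` at Lehmer's pair (`ldSub_check` + `ldQRunWithL_sound` +
the dip data `dip_data` of the main window file + the glue step `not_linearRay_of_data`), closing the gap
`(7/10, 1)` of the C15 census; then the union with the main window `[1, 21]`
(`not_hasOnlyRealZeros_linearFactorH_of_abs_mem_Icc`) and with the tree's wide/medium windows
`0 < |a| ≤ 7/10` (`Splittings.LinearRayOnePoint.not_hasOnlyRealZeros_linearFactorH_of_abs_le_seven_tenths`,
rh-splitx-eng-5 g2/g3): **for every real `a` with `0 < |a| ≤ 21`, `linearFactorH a` has a non-real zero**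
(`not_hasOnlyRealZeros_linearFactorH_of_abs_le_twentyOne`).  OPEN: `|a| > 21` and the `a`-uniform statement.
Axioms: std + the declared `native_decide` axioms of this lane (`ldDip/ldLow/ldHigh/ldSub_check`), of the
engine (`hiWin1/hiWin2_check`) and of the one-point lane (`linRayGap/linRayWindowA/linRayWindowB_check`).
HONEST LABEL: the ray is RH-STRENGTHENING (`riemannHypothesis_of_exists_linearRay`); refuting it below
`|a| ≤ 21` is RH-free negative-side bookkeeping for the C15 census — not a splitting; nothing here bears on
the truth of RH.
-/

set_option linter.dupNamespace false

noncomputable section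

namespace Summit.RiemannHypothesis.RiemannHypothesis.Theorems.Splittings.LinearRayLehmerWindow

open Set MeasureTheory
open Literature.NumberTheory.LFunctions Literature.NumberTheory.LFunctions.ZetaNumerics
open Literature.Barriers.RiemannHypothesis (linearFactorH)

/-- **The linear-factor ray is refuted for `2/5 ≤ a ≤ 1`** (sub-unity window, decay-aware tail). [folklore] -/
theorem not_hasOnlyRealZeros_linearFactorH_sub {a : ℝ} (ha : a ∈ Icc (2 / 5 : ℝ) 1) :
    ¬ HasOnlyRealZeros (linearFactorH a) := by
  obtain ⟨hM0, q, -, hq, hmargin⟩ := ldQRunWithL_sound (oT := UniversalFactor.lehmerTables) lehmerTables_valid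
    ldSub_check (a := a)
    (by simp only [ldAsSub, List.getD_cons_zero]; push_cast; linarith [ha.1])
    (by simp only [ldAsSub, List.length_cons, List.length_nil, List.getD_cons_succ, List.getD_cons_zero]
        push_cast; linarith [ha.2])
  obtain ⟨hHx, hM⟩ := dip_data
  exact not_linearRay_of_data (by linarith [ha.1]) (by positivity)
    (by have := lehmerT0_bounds; push_cast; linarith) (by exact_mod_cast hM0) hHx hq hM hmargin

/-- **The linear-factor ray is refuted for `2/5 ≤ a ≤ 21`** (Lehmer's pair, both windows). [folklore] -/
theorem not_hasOnlyRealZeros_linearFactorH_of_mem_Icc' {a : ℝ} (ha : a ∈ Icc (2 / 5 : ℝ) 21) :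
    ¬ HasOnlyRealZeros (linearFactorH a) := by
  by_cases h1 : a ≤ 1
  · exact not_hasOnlyRealZeros_linearFactorH_sub ⟨ha.1, h1⟩
  · exact not_hasOnlyRealZeros_linearFactorH_of_mem_Icc ⟨(not_le.1 h1).le, ha.2⟩

/-- **Main theorem of the lane.** For every real `a` with `0 < |a| ≤ 21` the linear-factor deformation
`linearFactorH a` of `H_0 = deBruijnH 0` has a zero off the real axis: the linear-factor ray of
`Literature/Barriers/RiemannHypothesis/NewmanConjecture.lean` is refuted below `|a| ≤ 21` — wide window and
`a₀` gap (residue + Hadamard-free growth argument, g2), `[0.31935, 7/10]` (one-point Laguerre certificates at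
`γ₆₃/γ₆₄`, g3), `[2/5, 21]` (two-point certificate at Lehmer's pair, this lane); RH-free. [folklore] -/
theorem not_hasOnlyRealZeros_linearFactorH_of_abs_le_twentyOne {a : ℝ} (ha : a ≠ 0) (h : |a| ≤ 21) :
    ¬ HasOnlyRealZeros (linearFactorH a) := by
  by_cases h7 : |a| ≤ 7 / 10
  · exact LinearRayOnePoint.not_hasOnlyRealZeros_linearFactorH_of_abs_le_seven_tenths ha h7
  · have h25 : 2 / 5 ≤ |a| := by push Not at h7; linarith
    rcases le_or_gt 0 a with h0 | h0
    · rw [abs_of_nonneg h0] at h25 h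
      exact not_hasOnlyRealZeros_linearFactorH_of_mem_Icc' ⟨h25, h⟩
    · rw [abs_of_neg h0] at h25 h
      rw [← Literature.Barriers.RiemannHypothesis.hasOnlyRealZeros_linearFactorH_neg_iff]
      exact not_hasOnlyRealZeros_linearFactorH_of_mem_Icc' ⟨h25, h⟩

/-- The same with an explicit non-real zero. [folklore] -/
theorem exists_nonreal_zero_linearFactorH_of_abs_le_twentyOne {a : ℝ} (ha : a ≠ 0) (h : |a| ≤ 21) :
    ∃ z : ℂ, linearFactorH a z = 0 ∧ z.im ≠ 0 := by
  have h' := not_hasOnlyRealZeros_linearFactorH_of_abs_le_twentyOne ha h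
  simp only [HasOnlyRealZeros, not_forall, exists_prop] at h'
  obtain ⟨z, hz, hzim⟩ := h'
  exact ⟨z, hz, hzim⟩

end Summit.RiemannHypothesis.RiemannHypothesis.Theorems.Splittings.LinearRayLehmerWindow

end
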